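import Literature.Analysis.FluidPDE.PassiveScalarDiagForcedTrace
import Literature.Analysis.FluidPDE.PassiveScalarDiagForcedCongr
import HarnessLib

/-!
# Restart of weak diagonal-diffusion passive scalars with a source at intermediate times

Analysis/FluidPDE proof-support file (everything proved). For a weak solution `θ` of
`∂ₜθ + u·∇θ = κ ∑ᵢ aᵢ ∂ᵢ∂ᵢθ + s` on `T^d × [0,T)` with datum `θ₀`
(`Torus.IsWeakScalarTransportDiagForcedOn T a κ u s θ₀ θ`; DiPerna–Lions 1989, §II.1 (12)–(14) with
a source, diagonal diffusion) and a time `σ ∈ [0,T)`: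

* `IsWeakScalarTransportDiagForcedOn.translate` — **restart**: if `θσ` satisfies the TRACE
  IDENTITIES at `σ` (`∫ θσ g = ∫ θ₀ g + ∫_{(0,σ]} (∫ θ (⟪u, ∇g⟫ + κ ∑ᵢ aᵢ ∂ᵢ∂ᵢ g) + ∫ s g)` for every
  smooth steady `g`; e.g. the slice `w(σ)` of the weakly continuous representative,
  `PassiveScalarDiagForcedTrace`), then the translate `t ↦ θ(σ + t)` is a weak solution on
  `T^d × [0, T - σ)` with drift `u(σ + ·)`, source `s(σ + ·)` and datum `θσ`. Proof: the weak
  formulation tested with `ψ(· - σ)` (`ψ` a test function on `[0, T - σ)`), the time integral split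
  at `σ`; the piece over `(0,σ]` plus the datum term is the value at `σ` of the absolutely
  continuous representative of `t ↦ ∫ θ(t) ψ(t - σ)` (`ae_integral_mul_spaceTime_eq`), which
  equals the trace `P_{ψ(0)}(σ)` because the two continuous functions differ, for a.e. `t`, by
  `∫ θ(t) (ψ(t - σ) - ψ(0)) = O(|t - σ|)`; a change of variables `t = σ + τ` finishes. No
  integrability of `θσ` is needed (the datum enters only through the trace identities), and no
  sign condition on `a`, `κ`.
* `….translate_representative` — restart from the weakly continuous representative at every
  `σ ∈ [0,T)`. The global class and the "integer periods" form consumed by the scalar zeroth-law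
  bookkeeping of cell `ad-ideate` (ROUND-10 §B3 / ROUND-11 §2.1 (T3)) are in
  `PassiveScalarDiagForcedRestartGlobal`.

## Mathlib / tree search

Tree: time-shift bookkeeping exists for the isotropic classes in several places
(`PassiveScalarForcedTrace`, `PassiveScalarReleasePairing`, Summits-side `LapInventory`,
`LerayHopfTranslate`); none for the diagonal class, and no restart theorem for
`IsWeakScalarTransport(Forced)On` either (`lean search 'translate|restart'` in
`FluidPDE/PassiveScalar*`). Mathlib: `MeasurePreserving.integral_comp`,
`Convex.norm_image_sub_le_of_norm_deriv_le`, `intervalIntegral.integral_add_adjacent_intervals`,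
`Measure.eqOn_Icc_of_ae_eq`.

## References

* R. J. DiPerna, P.-L. Lions, Invent. Math. 98 (1989), §II.1, (12)–(14); the restart /
  semigroup property of renormalized solutions, §II.3. [`DiPernaLions1989`]
* A. Pazy, *Semigroups of Linear Operators and Applications to PDE* (Springer 1983), Ch. 5,
  §5.1–5.2 (evolution systems `U(t,s)`). [`Pazy1983`]
-/

noncomputable section

open _root_.MeasureTheory _root_.Set _root_.Filter _root_.Function _root_.TopologicalSpace
open scoped ENNReal NNReal InnerProductSpace ContDiff

namespace Literature.Analysis.FluidPDE

namespace Torus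

open Literature.Analysis.FunctionSpaces.Torus Literature.Analysis.FunctionSpaces

variable {d : Type*} [Fintype d] [DecidableEq d]

/-! ## Time shifts `t ↦ σ + t`: measure preservation and transfer lemmas -/

section Shift

omit [Fintype d] [DecidableEq d] in
/-- `t ↦ σ + t` maps Lebesgue measure on `(0,T')` to Lebesgue measure on `(σ, σ + T')`. [folklore] -/
private theorem measurePreserving_shift (σ T' : ℝ) :
    MeasurePreserving (fun t : ℝ => σ + t) ((volume : Measure ℝ).restrict (Ioo 0 T'))
      ((volume : Measure ℝ).restrict (Ioo σ (σ + T'))) := by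
  have h := (measurePreserving_add_left (volume : Measure ℝ) σ).restrict_preimage
    (measurableSet_Ioo (a := σ) (b := σ + T'))
  have hpre : (fun t : ℝ => σ + t) ⁻¹' Ioo σ (σ + T') = Ioo 0 T' := by
    ext t; simp
  rwa [hpre] at h

omit [DecidableEq d] in
/-- `(t, x) ↦ (σ + t, x)` maps `(0,T') × T^d` to `(σ, σ+T') × T^d` preserving measure. [folklore] -/
private theorem measurePreserving_shift_prod (σ T' : ℝ) :
    MeasurePreserving (fun p : ℝ × UnitAddTorus d => (σ + p.1, p.2))
      (((volume : Measure ℝ).restrict (Ioo 0 T')).prod volume)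
      (((volume : Measure ℝ).restrict (Ioo σ (σ + T'))).prod volume) :=
  (measurePreserving_shift σ T').prod (MeasurePreserving.id volume)

omit [Fintype d] [DecidableEq d] in
/-- An a.e. property on `(0,T)` holds a.e. along the shift on `(0,T')` when `(σ, σ+T') ⊆ (0,T)`.
[folklore] -/
private theorem ae_shift {T σ T' : ℝ} {P : ℝ → Prop}
    (h : ∀ᵐ t ∂((volume : Measure ℝ).restrict (Ioo 0 T)), P t) (hσ : 0 ≤ σ) (hT' : σ + T' ≤ T) :
    ∀ᵐ t ∂((volume : Measure ℝ).restrict (Ioo 0 T')), P (σ + t) := by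
  have h1 : ∀ᵐ t ∂((volume : Measure ℝ).restrict (Ioo σ (σ + T'))), P t :=
    ae_restrict_of_ae_restrict_of_subset (Ioo_subset_Ioo hσ hT') h
  exact (measurePreserving_shift σ T').quasiMeasurePreserving.ae h1

omit [Fintype d] [DecidableEq d] in
/-- A lower integral over a shifted subwindow is at most the full one. [folklore] -/
private theorem setLIntegral_shift_le {F : ℝ → ℝ≥0∞} {T σ T' : ℝ} (hσ : 0 ≤ σ) (hT' : σ + T' ≤ T) :
    ∫⁻ t in Ioo 0 T', F (σ + t) ≤ ∫⁻ t in Ioo 0 T, F t := by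
  have hme : MeasurableEmbedding (fun t : ℝ => σ + t) := (MeasurableEquiv.addLeft σ).measurableEmbedding
  calc ∫⁻ t in Ioo 0 T', F (σ + t) = ∫⁻ t in Ioo σ (σ + T'), F t :=
        (measurePreserving_shift σ T').lintegral_comp_emb hme F
    _ ≤ ∫⁻ t in Ioo 0 T, F t := lintegral_mono_set (Ioo_subset_Ioo hσ hT')

omit [Fintype d] [DecidableEq d] in
/-- Integrability on `(0,T)` passes to the shift on `(0,T')` when `(σ, σ+T') ⊆ (0,T)`. [folklore] -/
private theorem integrableOn_shift {E : Type*} [NormedAddCommGroup E] {F : ℝ → E} {T σ T' : ℝ}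
    (h : IntegrableOn F (Ioo 0 T) volume) (hσ : 0 ≤ σ) (hT' : σ + T' ≤ T) :
    IntegrableOn (fun t => F (σ + t)) (Ioo 0 T') volume := by
  have hme : MeasurableEmbedding (fun t : ℝ => σ + t) := (MeasurableEquiv.addLeft σ).measurableEmbedding
  have hpre : (fun t : ℝ => σ + t) ⁻¹' Ioo σ (σ + T') = Ioo 0 T' := by
    ext t; simp
  have := ((measurePreserving_add_left (volume : Measure ℝ) σ).integrableOn_comp_preimage hme
    (f := F) (s := Ioo σ (σ + T'))).2 (h.mono_set (Ioo_subset_Ioo hσ hT'))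
  rwa [hpre] at this

omit [Fintype d] [DecidableEq d] in
/-- Change of variables `t = σ + τ` in a Bochner integral over a shifted window. [folklore] -/
private theorem setIntegral_shift {E : Type*} [NormedAddCommGroup E] [NormedSpace ℝ E]
    (F : ℝ → E) (σ T' : ℝ) :
    ∫ t in Ioo 0 T', F (σ + t) = ∫ t in Ioo σ (σ + T'), F t :=
  (measurePreserving_shift σ T').integral_comp (MeasurableEquiv.addLeft σ).measurableEmbedding F

omit [DecidableEq d] in
/-- Joint measurability on `(0,T) × T^d` passes to the shift on `(0,T') × T^d`. [folklore] -/
private theorem aestronglyMeasurable_uncurry_shift {E : Type*} [TopologicalSpace E]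
    {F : ℝ → UnitAddTorus d → E} {T σ T' : ℝ}
    (h : AEStronglyMeasurable (uncurry F) (((volume : Measure ℝ).restrict (Ioo 0 T)).prod volume))
    (hσ : 0 ≤ σ) (hT' : σ + T' ≤ T) :
    AEStronglyMeasurable (uncurry fun t x => F (σ + t) x)
      (((volume : Measure ℝ).restrict (Ioo 0 T')).prod volume) := by
  have hle : ((volume : Measure ℝ).restrict (Ioo σ (σ + T'))).prod (volume : Measure (UnitAddTorus d)) ≤
      ((volume : Measure ℝ).restrict (Ioo 0 T)).prod volume :=
    Measure.prod_mono (Measure.restrict_mono_set _ (Ioo_subset_Ioo hσ hT')) le_rfl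
  have e : (uncurry fun t x => F (σ + t) x) = uncurry F ∘ fun p : ℝ × UnitAddTorus d => (σ + p.1, p.2) := by
    funext p; rfl
  rw [e]
  exact (h.mono_measure hle).comp_measurePreserving (measurePreserving_shift_prod σ T')

end Shift

/-! ## Tools: a.e. versus everywhere for continuous functions; shifted test functions -/

section Tools

omit [Fintype d] [DecidableEq d] in
/-- A function continuous on `[0,T]` which is `≤ M` for a.e. `t ∈ (0,T)` is `≤ M` on `[0,T]`
(`T > 0`). [folklore] -/
private theorem le_on_Icc_of_ae_le {T : ℝ} (hT : 0 < T) {f : ℝ → ℝ} {M : ℝ}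
    (hf : ContinuousOn f (Icc 0 T)) (h : ∀ᵐ t ∂(volume.restrict (Ioo 0 T)), f t ≤ M) :
    ∀ t ∈ Icc 0 T, f t ≤ M := by
  have hae : ∀ᵐ t ∂(volume.restrict (Icc 0 T)), (fun t => max (f t) M) t = (fun _ => M) t := by
    have e : (volume : Measure ℝ).restrict (Icc 0 T) = volume.restrict (Ioo 0 T) :=
      Measure.restrict_congr_set Ioo_ae_eq_Icc.symm
    rw [e]
    filter_upwards [h] with t ht
    exact max_eq_right ht
  have key := Measure.eqOn_Icc_of_ae_eq (μ := volume) hT.ne hae (hf.sup continuousOn_const)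
    continuousOn_const
  intro t ht
  have h1 : max (f t) M = M := key ht
  exact (le_max_left _ _).trans h1.le

variable {T σ : ℝ} {ψ : ℝ → UnitAddTorus d → ℝ}

omit [DecidableEq d] in
/-- A test function on `[0, T - σ)` shifted forward by `σ` is a test function on `[0,T)`. [folklore] -/
private theorem isSpaceTimeTest_shift (hψ : IsSpaceTimeTest (T - σ) ψ) :
    IsSpaceTimeTest T (fun t x => ψ (t - σ) x) := by
  obtain ⟨hs, T₁, hT₁, h0⟩ := hψ
  refine ⟨?_, T₁ + σ, by linarith, fun t ht => ?_⟩
  · have e : stLift (fun t x => ψ (t - σ) x) = stLift ψ ∘ fun p : ℝ × EuclideanSpace ℝ d => (p.1 - σ, p.2) := by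
      funext p; rfl
    rw [e]
    exact hs.comp ((contDiff_fst.sub contDiff_const).prodMk contDiff_snd)
  · show ψ (t - σ) = 0
    exact h0 _ (by linarith)

omit [Fintype d] [DecidableEq d] in
/-- Time derivative of the shifted test function: `∂ₜ(ψ(· - σ))(t) = (∂ₜψ)(t - σ)`. [folklore] -/
private theorem timeDeriv_shift (ψ : ℝ → UnitAddTorus d → ℝ) (σ t : ℝ) (x : UnitAddTorus d) :
    FunctionSpaces.Torus.timeDeriv (fun t x => ψ (t - σ) x) t x = FunctionSpaces.Torus.timeDeriv ψ (t - σ) x := by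
  simp only [FunctionSpaces.Torus.timeDeriv]
  exact deriv_comp_sub_const (fun τ => ψ τ x) σ t

omit [DecidableEq d] in
/-- Slices `τ ↦ ψ τ x` of a space–time test function are differentiable, with derivative the
time derivative. [folklore] -/
private theorem hasDerivAt_slice_test {T' : ℝ} (hψ : IsSpaceTimeTest T' ψ) (t : ℝ) (x : UnitAddTorus d) :
    HasDerivAt (fun τ => ψ τ x) (FunctionSpaces.Torus.timeDeriv ψ t x) t := by
  obtain ⟨y, rfl⟩ := proj_surjective x
  have h : (fun τ => ψ τ (proj y)) = stLift ψ ∘ fun τ => (τ, y) := by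
    funext τ; simp [stLift_apply]
  have hdiff : Differentiable ℝ (fun τ => ψ τ (proj y)) := by
    rw [h]
    exact (hψ.1.differentiable (by simp)).comp (differentiable_id.prodMk (differentiable_const _))
  exact (hdiff t).hasDerivAt

omit [DecidableEq d] in
/-- **Lipschitz dependence in time** of a space–time test function on `[0,T']`:
`|ψ(t, x) - ψ(t₀, x)| ≤ L |t - t₀|` with `L = sup_{[0,T'] × T^d} |∂ₜψ|` (mean value theorem).
[folklore] -/
private theorem exists_lipschitz_time {T' : ℝ} (hψ : IsSpaceTimeTest T ψ) :
    ∃ L : ℝ, 0 ≤ L ∧ ∀ t ∈ Icc 0 T', ∀ t₀ ∈ Icc 0 T', ∀ x, |ψ t x - ψ t₀ x| ≤ L * |t - t₀| := by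
  obtain ⟨L, hL⟩ := hψ.exists_bound_timeDeriv (isCompact_Icc (a := 0) (b := T'))
  refine ⟨max L 0, le_max_right _ _, fun t ht t₀ ht₀ x => ?_⟩
  have h := Convex.norm_image_sub_le_of_norm_deriv_le (f := fun τ => ψ τ x) (s := Icc 0 T')
    (fun τ _ => (hasDerivAt_slice_test hψ τ x).differentiableAt)
    (fun τ hτ => by
      rw [(hasDerivAt_slice_test hψ τ x).deriv]
      exact (hL τ hτ x).trans (le_max_left L 0))
    (convex_Icc 0 T') ht₀ ht
  simpa only [Real.norm_eq_abs] using h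

end Tools

namespace IsWeakScalarTransportDiagForcedOn

variable {T κ : ℝ} {a : d → ℝ} {u : ℝ → UnitAddTorus d → EuclideanSpace ℝ d}
  {s : ℝ → UnitAddTorus d → ℝ} {θ₀ : UnitAddTorus d → ℝ} {θ : ℝ → UnitAddTorus d → ℝ}

/-! ## Restart from a trace datum -/

/-- **Restart at an intermediate time from the trace.** Let `θ` be a weak solution of
`∂ₜθ + u·∇θ = κ ∑ᵢ aᵢ ∂ᵢ∂ᵢθ + s` on `T^d × [0,T)` with datum `θ₀`, let `0 ≤ σ < T`, and let `θσ`
satisfy the trace identities at `σ`: for every smooth steady `g`,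
`∫ θσ g = ∫ θ₀ g + ∫_{(0,σ]} (∫ θ(τ) (⟪u(τ), ∇g⟫ + κ ∑ᵢ aᵢ ∂ᵢ∂ᵢ g) + ∫ s(τ) g) dτ`. Then the translate
`t ↦ θ(σ + t)` is a weak solution on `T^d × [0, T - σ)` with drift `u(σ + ·)`, source `s(σ + ·)`
and datum `θσ` (the evolution / semigroup property of the linear problem, DiPerna–Lions 1989,
§II.1 and §II.3; Pazy 1983, §5.1). [cite: DiPernaLions1989, §II.1 (12)–(14)] -/
theorem translate (h : IsWeakScalarTransportDiagForcedOn T a κ u s θ₀ θ) {σ : ℝ} (hσ : 0 ≤ σ)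
    (hσT : σ < T) {θσ : UnitAddTorus d → ℝ}
    (htr : ∀ g : UnitAddTorus d → ℝ, IsSmooth g →
      ∫ x, θσ x * g x = (∫ x, θ₀ x * g x) +
        ∫ τ in Ioc 0 σ, ((∫ x, θ τ x * (⟪u τ x, gradient g x⟫_ℝ +
          κ * ∑ i, a i * FunctionSpaces.Torus.partialDeriv i (FunctionSpaces.Torus.partialDeriv i g) x)) +
          ∫ x, s τ x * g x)) :
    IsWeakScalarTransportDiagForcedOn (T - σ) a κ (fun t => u (σ + t)) (fun t => s (σ + t)) θσ
      (fun t => θ (σ + t)) := by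
  have hTT : σ + (T - σ) ≤ T := by linarith
  have hT : 0 < T := hσ.trans_lt hσT
  obtain ⟨C, hC⟩ := h.ae_lintegral_sq_le
  refine ⟨?_, ?_, ?_, ⟨C, ae_shift hC hσ hTT⟩, ?_, ?_, ?_, ae_shift h.ae_isWeaklyDivFree hσ hTT, ?_⟩
  · exact aestronglyMeasurable_stLift_of_uncurry
      (aestronglyMeasurable_uncurry_shift h.aestronglyMeasurable_uncurry hσ hTT)
  · exact aestronglyMeasurable_stLift_of_uncurry
      (aestronglyMeasurable_uncurry_shift h.aestronglyMeasurable_uncurry_velocity hσ hTT)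
  · exact aestronglyMeasurable_stLift_of_uncurry
      (aestronglyMeasurable_uncurry_shift h.aestronglyMeasurable_uncurry_source hσ hTT)
  · exact (setLIntegral_shift_le (F := fun t => (∫⁻ x, ‖u t x‖ₑ ^ 2) ^ (1 / 2 : ℝ)) hσ hTT).trans_lt
      h.lintegral_velocity_lt_top
  · exact (setLIntegral_shift_le (F := fun t => ∫⁻ x, ‖u t x‖ₑ * ‖θ t x‖ₑ) hσ hTT).trans_lt
      h.lintegral_mul_lt_top
  · exact (setLIntegral_shift_le (F := fun t => ∫⁻ x, ‖s t x‖ₑ) hσ hTT).trans_lt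
      h.lintegral_source_lt_top
  -- the weak formulation
  intro ψ hψ
  -- the shifted test function on `[0,T)` and its weak integrand
  set ψσ : ℝ → UnitAddTorus d → ℝ := fun t x => ψ (t - σ) x with hψσ_def
  have hψσ : IsSpaceTimeTest T ψσ := isSpaceTimeTest_shift hψ
  have hψσ_shift : ∀ t, ψσ (σ + t) = ψ t := fun t => by
    funext x; simp only [hψσ_def, add_sub_cancel_left]
  have hψσ_σ : ψσ σ = ψ 0 := by
    have := hψσ_shift 0; rwa [add_zero] at this
  set W : ℝ → UnitAddTorus d → ℝ := fun t x => FunctionSpaces.Torus.timeDeriv ψσ t x + ⟪u t x, gradient (ψσ t) x⟫_ℝ +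
    κ * ∑ i, a i * FunctionSpaces.Torus.partialDeriv i (FunctionSpaces.Torus.partialDeriv i (ψσ t)) x
    with hW_def
  have hW_shift : ∀ (t : ℝ) (x : UnitAddTorus d), W (σ + t) x =
      FunctionSpaces.Torus.timeDeriv ψ t x + ⟪u (σ + t) x, gradient (ψ t) x⟫_ℝ +
        κ * ∑ i, a i * FunctionSpaces.Torus.partialDeriv i (FunctionSpaces.Torus.partialDeriv i (ψ t)) x := by
    intro t x
    simp only [hW_def, hψσ_shift t]
    rw [timeDeriv_shift, add_sub_cancel_left]
  -- the two time integrands `A` (weak integrand) and `B` (source) and their integrability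
  set A : ℝ → ℝ := fun t => ∫ x, θ t x * W t x with hA_def
  set B : ℝ → ℝ := fun t => ∫ x, s t x * ψσ t x with hB_def
  have hWint := h.integrable_weakIntegrand hψσ
  have hSint := h.integrable_source_mul_test hψσ
  have hA : IntegrableOn A (Ioo 0 T) volume := hWint.integral_prod_left
  have hB : IntegrableOn B (Ioo 0 T) volume := hSint.integral_prod_left
  have hF : IntegrableOn (fun t => A t + B t) (Ioo 0 T) volume := hA.add hB
  -- (1) the weak formulation of `θ` tested with `ψσ`: `∫_{(0,T)} (A + B) + ∫ θ₀ ψσ(0) = 0`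
  have hweak : (∫ t in Ioo 0 T, (A t + B t)) + ∫ x, θ₀ x * ψσ 0 x = 0 := by
    have key := h.weak_eq ψσ hψσ
    rw [integral_add hA hB]
    simpa only [hA_def, hB_def, hW_def] using key
  -- (2) splitting the time integral at `σ`
  have hsplit : ∫ t in Ioo 0 T, (A t + B t) =
      (∫ t in Ioc 0 σ, (A t + B t)) + ∫ t in Ioo σ T, (A t + B t) := by
    have hF' : IntegrableOn (fun t => A t + B t) (Ioc 0 T) volume := hF.congr_set_ae Ioo_ae_eq_Ioc.symm
    have h1 : IntervalIntegrable (fun t => A t + B t) volume 0 σ :=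
      (intervalIntegrable_iff_integrableOn_Ioc_of_le hσ).2 (hF'.mono_set (Ioc_subset_Ioc_right hσT.le))
    have h2 : IntervalIntegrable (fun t => A t + B t) volume σ T :=
      (intervalIntegrable_iff_integrableOn_Ioc_of_le hσT.le).2 (hF'.mono_set (Ioc_subset_Ioc_left hσ))
    rw [← integral_Ioc_eq_integral_Ioo (x := (0 : ℝ)) (y := T), ← integral_Ioc_eq_integral_Ioo (x := σ) (y := T),
      ← intervalIntegral.integral_of_le hT.le, ← intervalIntegral.integral_of_le hσ,
      ← intervalIntegral.integral_of_le hσT.le]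
    exact (intervalIntegral.integral_add_adjacent_intervals h1 h2).symm
  -- (3) the absolutely continuous representative `Q` of `t ↦ ∫ θ(t) ψσ(t)` and the trace `P` of `g = ψ 0`
  set Q : ℝ → ℝ := fun t => (∫ x, θ₀ x * ψσ 0 x) + ∫ τ in Ioc 0 t, (A τ + B τ) with hQ_def
  have hg : IsSmooth (ψ 0) := hψ.isSmooth_slice 0
  set P : ℝ → ℝ := fun t => (∫ x, θ₀ x * ψ 0 x) +
      ∫ τ in Ioc 0 t, ((∫ x, θ τ x * (⟪u τ x, gradient (ψ 0) x⟫_ℝ +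
        κ * ∑ i, a i * FunctionSpaces.Torus.partialDeriv i (FunctionSpaces.Torus.partialDeriv i (ψ 0)) x)) +
        ∫ x, s τ x * ψ 0 x) with hP_def
  have hQc : ContinuousOn Q (Icc 0 T) :=
    continuousOn_const.add (intervalIntegral.continuousOn_primitive (hF.congr_set_ae Ioo_ae_eq_Icc.symm))
  have hPc : ContinuousOn P (Icc 0 T) := h.continuousOn_pairingPrimitive hg
  have hQae : ∀ᵐ t ∂(volume.restrict (Ioo 0 T)), ∫ x, θ t x * ψσ t x = Q t := by
    filter_upwards [h.ae_integral_mul_spaceTime_eq hψσ.1] with t ht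
    simpa only [hQ_def, hA_def, hB_def, hW_def] using ht
  have hPae : ∀ᵐ t ∂(volume.restrict (Ioo 0 T)), ∫ x, θ t x * ψ 0 x = P t := by
    filter_upwards [h.ae_integral_mul_eq hg] with t ht
    simpa only [hP_def] using ht
  -- (4) `Q σ = P σ`: the continuous function `|Q - P| - K |· - σ|` is `≤ 0` a.e., hence at `σ`
  obtain ⟨L, hL0, hL⟩ := exists_lipschitz_time (T' := T) hψσ
  obtain ⟨Cg, hCg⟩ := exists_forall_norm_le_of_continuous hg.continuous
  obtain ⟨C₁, hC₁⟩ := h.exists_eLpNorm_le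
  have hbound : ∀ᵐ t ∂(volume.restrict (Ioo 0 T)), |Q t - P t| - (C₁ : ℝ) * L * |t - σ| ≤ 0 := by
    filter_upwards [hQae, hPae, h.ae_slice_integrable, hC₁, h.ae_memLp_two,
      ae_restrict_mem measurableSet_Ioo] with t htQ htP hti ht₁ htm htI
    obtain ⟨hθi, -, -, -⟩ := hti
    have htIcc : t ∈ Icc 0 T := Ioo_subset_Icc_self htI
    have hσIcc : σ ∈ Icc 0 T := ⟨hσ, hσT.le⟩
    have hψc : Continuous (ψσ t) := (hψσ.isSmooth_slice t).continuous
    obtain ⟨Cψ, hCψ⟩ := exists_forall_norm_le_of_continuous hψc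
    have i1 : Integrable (fun x => θ t x * ψσ t x) volume :=
      hθi.mul_bdd hψc.aestronglyMeasurable (Eventually.of_forall hCψ)
    have i2 : Integrable (fun x => θ t x * ψ 0 x) volume :=
      hθi.mul_bdd hg.continuous.aestronglyMeasurable (Eventually.of_forall hCg)
    have hdiff : Q t - P t = ∫ x, θ t x * (ψσ t x - ψ 0 x) := by
      rw [← htQ, ← htP, ← integral_sub i1 i2]
      exact integral_congr_ae (Eventually.of_forall fun x => by ring)
    -- `∫ |θ t| ≤ C₁`
    have hL1 : ∫ x, |θ t x| ≤ (C₁ : ℝ) := by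
      have e1 : ∫ x, |θ t x| = (∫⁻ x, ‖θ t x‖ₑ).toReal := by
        rw [← integral_norm_eq_lintegral_enorm hθi.aestronglyMeasurable]
        simp only [Real.norm_eq_abs]
      have e2 : ∫⁻ x, ‖θ t x‖ₑ = eLpNorm (θ t) 1 volume := by rw [eLpNorm_one_eq_lintegral_enorm]
      rw [e1, e2]
      have h12 : eLpNorm (θ t) 1 volume ≤ C₁ :=
        (eLpNorm_le_eLpNorm_of_exponent_le (by norm_num) htm.1).trans ht₁
      have := ENNReal.toReal_mono ENNReal.coe_ne_top h12
      simpa using this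
    have hpt : ∀ x, |θ t x * (ψσ t x - ψ 0 x)| ≤ L * |t - σ| * |θ t x| := by
      intro x
      rw [abs_mul, mul_comm]
      refine mul_le_mul_of_nonneg_right ?_ (abs_nonneg _)
      have := hL t htIcc σ hσIcc x
      rwa [hψσ_σ] at this
    have hest : |Q t - P t| ≤ (C₁ : ℝ) * L * |t - σ| := by
      rw [hdiff]
      calc |∫ x, θ t x * (ψσ t x - ψ 0 x)| ≤ ∫ x, |θ t x * (ψσ t x - ψ 0 x)| := abs_integral_le_integral_abs
        _ ≤ ∫ x, L * |t - σ| * |θ t x| :=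
            integral_mono_of_nonneg (Eventually.of_forall fun x => abs_nonneg _)
              (hθi.abs.const_mul _) (Eventually.of_forall hpt)
        _ = L * |t - σ| * ∫ x, |θ t x| := integral_const_mul _ _
        _ ≤ L * |t - σ| * C₁ := mul_le_mul_of_nonneg_left hL1 (by positivity)
        _ = (C₁ : ℝ) * L * |t - σ| := by ring
    linarith
  have hcont : ContinuousOn (fun t => |Q t - P t| - (C₁ : ℝ) * L * |t - σ|) (Icc 0 T) :=
    ((hQc.sub hPc).abs).sub (continuousOn_const.mul ((continuousOn_id.sub continuousOn_const).abs))
  have hQP : Q σ = P σ := by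
    have h0 := le_on_Icc_of_ae_le hT hcont hbound σ ⟨hσ, hσT.le⟩
    simp only [sub_self, abs_zero, mul_zero, sub_zero] at h0
    have : |Q σ - P σ| = 0 := le_antisymm h0 (abs_nonneg _)
    rwa [abs_eq_zero, sub_eq_zero] at this
  -- (5) the trace identity: `P σ = ∫ θσ ψ(0)`
  have hPσ : P σ = ∫ x, θσ x * ψ 0 x := by
    rw [htr (ψ 0) hg]
  -- (6) assembling: `∫_{(σ,T)} (A + B) = - Q σ`, then change variables `t = σ + τ`
  have hIσT : ∫ t in Ioo σ T, (A t + B t) = -∫ x, θσ x * ψ 0 x := by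
    have e : Q σ = (∫ x, θ₀ x * ψσ 0 x) + ∫ τ in Ioc 0 σ, (A τ + B τ) := rfl
    rw [← hPσ, ← hQP]
    linarith [hweak, hsplit, e]
  have hAσ : IntegrableOn (fun t => A (σ + t)) (Ioo 0 (T - σ)) volume := integrableOn_shift hA hσ hTT
  have hBσ : IntegrableOn (fun t => B (σ + t)) (Ioo 0 (T - σ)) volume := integrableOn_shift hB hσ hTT
  have hcv : ∫ t in Ioo 0 (T - σ), (A (σ + t) + B (σ + t)) = ∫ t in Ioo σ T, (A t + B t) := by
    have := setIntegral_shift (fun t => A t + B t) σ (T - σ)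
    rwa [add_sub_cancel] at this
  have hAe : ∫ t in Ioo 0 (T - σ), A (σ + t) =
      ∫ t in Ioo 0 (T - σ), ∫ x, θ (σ + t) x *
        (FunctionSpaces.Torus.timeDeriv ψ t x + ⟪u (σ + t) x, gradient (ψ t) x⟫_ℝ +
          κ * ∑ i, a i * FunctionSpaces.Torus.partialDeriv i (FunctionSpaces.Torus.partialDeriv i (ψ t)) x) := by
    refine setIntegral_congr_fun measurableSet_Ioo fun t _ => ?_
    simp only [hA_def]
    exact integral_congr_ae (Eventually.of_forall fun x => by simp only [hW_shift t x])
  have hBe : ∫ t in Ioo 0 (T - σ), B (σ + t) =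
      ∫ t in Ioo 0 (T - σ), ∫ x, s (σ + t) x * ψ t x := by
    refine setIntegral_congr_fun measurableSet_Ioo fun t _ => ?_
    simp only [hB_def, hψσ_shift t]
  rw [← hAe, ← hBe, ← integral_add hAσ hBσ, hcv, hIσT]
  ring

/-- **Restart from the weakly continuous representative.** For `T > 0` there is a weakly
`L²`-continuous representative `w` of the weak solution `θ` on `[0,T]` (`w(t) = θ(t)` a.e. for
a.e. `t`, `PassiveScalarDiagForcedTrace`) such that, for EVERY `σ ∈ [0,T)`, the translate
`t ↦ θ(σ + t)` is a weak solution on `T^d × [0, T - σ)` with drift `u(σ + ·)`, source `s(σ + ·)`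
and the `L²` datum `w(σ)`. [cite: DiPernaLions1989, §II.1 (12)–(14)] -/
theorem translate_representative [Nonempty d] (hT : 0 < T)
    (h : IsWeakScalarTransportDiagForcedOn T a κ u s θ₀ θ) :
    ∃ w : ℝ → UnitAddTorus d → ℝ,
      AEStronglyMeasurable (stLift w) (volume.restrict (Ioi 0 ×ˢ univ)) ∧
      (∀ t, 0 ≤ t → MemLp (w t) 2 volume) ∧
      (∃ C : ℝ≥0, ∀ t, 0 ≤ t → ∫ x, w t x ^ 2 ≤ C) ∧
      (∀ᵐ t ∂(volume.restrict (Ioo 0 T)), w t =ᵐ[volume] θ t) ∧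
      (∀ g : UnitAddTorus d → ℝ, MemLp g 2 volume →
        ContinuousOn (fun t => ∫ x, w t x * g x) (Icc 0 T)) ∧
      ∀ σ ∈ Ico 0 T, IsWeakScalarTransportDiagForcedOn (T - σ) a κ (fun t => u (σ + t))
        (fun t => s (σ + t)) (w σ) (fun t => θ (σ + t)) := by
  obtain ⟨w, hwm, hw2, hwC, hae, hwc, htr⟩ := h.exists_weaklyContinuous_representative hT
  exact ⟨w, hwm, hw2, hwC, hae, hwc, fun σ hσ =>
    h.translate hσ.1 hσ.2 fun g hg => htr g hg σ (Ico_subset_Icc_self hσ)⟩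

end IsWeakScalarTransportDiagForcedOn

end Torus

end Literature.Analysis.FluidPDE

end
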